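import Literature.AlgebraicGeometry.Hu2025.Statements.S04ModelV.R103aModelR

/-!
# Hu 2025 (arXiv:2507.21400v1, Part I), §4.2.1 tail + §4.2.2 — «no common factor», Lem. 4.8 / 4.9 ‹chunk 4.7 / 4.8› [OPT],
# Def. 4.11 ‹chunk 4.10› parent / descendant / root polynomial, Def. 4.12 ‹chunk 4.11› partial descendant, with the
# two in-text claims C22L173 / C23L25: PARTITION-HU row 103, file b (`S04ModelV/R103bDescendants.lean`),
# STATEMENTS-FIRST typing (LADDER-RESOLUTION rung M-Hu-min, D-0089)

Text of record: chunks p0022 l.70–72, l.112–134, l.151–173 and p0023 l.1–26 of `paper:arxiv-2507.21400`;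
PDF cross-check `HOME/lit/res-lit-6/hu25/text/hu25_p048…p050.txt` (locators «p.N L0aa» = those files' line
numbers; PRINTED (PDF) item number = chunk number + 1 in §4, PARTITION-HU §0 CUSTODY ERRATUM; decl names follow
the PDF, docstrings carry both). The section `Descendants` (decls `HasNoCommonFactor` … `C23L25`) is
res-type-044's pre-draft body v2 (sha16 bf60e437d0a0d8f7, 2026-08-27T04:3xZ; v1 671b4c51a01475dd) kept
BYTE-IDENTICAL (row 104's pre-drafts consume these names) EXCEPT the res-ref-a10 M-HU PRE-READ fix (STATUS
2026-08-27T05:52:29Z): `IsPartialDescentStep` / `IsPartialParentOf` / `Def4_12` / `C23L25` are now AS PRINTED (the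
standing hypothesis «`f` multi-homogeneous» kept at every partial step) and res-type-044's hypothesis-free step lives on as
the siblings `IsPartialDescentStep_ours` / `IsPartialParentOf_ours` / `Def4_12_ours` / `C23L25_ours`; the sections `WpReduction` (Lem. 4.8, 4.9, with the platform parameters `rk`, `head` explicit) and
`DescendantsR2` (the term-wise reading R2 of Def. 4.11/4.12 and of the two claims) are by the row-103 typer of
record res-type-042, who re-read every locator of the whole file on the chunks and the PDF text (T9).

**Status of the source (D-0012): UNREFEREED PREPRINT UNDER ADJUDICATION.** Nothing from the preprint is asserted:
definitions are REAL Lean definitions over res-type-024's carriers, printed claims are `def … : Prop` CANDIDATES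
`[claim: Hu2025, status: under-review]`. No proofs, no `sorry`, no `instance`, no notation. HONEST CEILING (PARTITION-HU
header): Part I as printed claims resolution of singularity TYPES; the summit-type claim rests on the UNPOSTED Part II.
AI typing/adjudication is weaker than expert review.

Carriers = I-R's (file a): `rel` (block of a term), `mono` (chart monomial as exponent vector), `ModelRing σ T k`
(= `R`), `rhoVar t = x_t`, `toModel (img mono t) = x̄_t`, `varphi mono = φ`, `kerMH rel mono Φ = ker^mh φ_Φ`.

## Rendering choices (for the faithfulness lanes; each is a choice, none takes a side)
* A «multi-homogeneous EXPRESSION `f = Σ_i x_{(u_i,v_i)} n_i`» (Def. 4.11/4.12) is DATA beyond the polynomial `f`: a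
  finite list of pairs `(t_i, n_i)` (ϱ-variable of the block `F`, cofactor). One DESCENT STEP at the block `F` replaces
  every `x_{t_i}` by its `φ`-image `x̄_{t_i}` (Def. 4.11), a PARTIAL step replaces those with `i ∈ I_1` only (Def. 4.12,
  the split `I = I_1 ⊔ I_2` = a Boolean tag per list entry). Because the result depends on the chosen expression (e.g.
  `X·Y·n` may descend through `X` or through `Y`), «descendant» is typed as a RELATION, and «`f` is a parent of `h`» as
  the reflexive–transitive closure of the one-step relation (chunk p0022 l.164–165; reflexive so that «does not admit any
  parent other than itself», l.167–169, reads literally).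
* The standing hypothesis of Def. 4.11 «Let `f` … be a multi-homogeneous expression/polynomial» IS part of the full
  descent step (the parent is multi-homogeneous; hence «root polynomial» = no multi-homogeneous one-step parent other
  than itself, as the text uses it, e.g. Ex. 4.20 ‹chunk 4.19› p.54). For the PARTIAL step of Def. 4.12 BOTH options
  are typed: AS PRINTED (`IsPartialDescentStep`, hypothesis kept at every step) and OURS (`IsPartialDescentStep_ours`, not
  folded in: a partial descendant is not multi-homogeneous, yet the text chains «`f` parent of `g`, `g` parent of `h`»,
  p0023 l.22–23; the consumer puts multi-homogeneity on the root of the chain where the print does, Def. 4.15: «partial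
  descendant of a multi-homogenous binomial»).
* Monomials `m`, `m'` are carried by exponent vectors `a a' : σ ⊕ T →₀ ℕ` (as I-R's Def. 4.7); «common factor» = a variable dividing both.
-/

namespace Literature.AlgebraicGeometry.Hu2025.Statements.S04ModelV

open MvPolynomial

section Descendants

universe u v w x

variable {k : Type u} [CommRing k] {σ : Type v} {T : Type w} {𝔗 : Type x}
variable (rel : T → 𝔗) (mono : T → (σ →₀ ℕ))

/-! ## «no common factor» (chunk p0022 l.70–72; PDF p.48) -/

/-- **Hu 2025, chunk p0022 l.70–72; PDF p.48 (before Lem. 4.8)**, verbatim: «As usual, we say `f` has no common factor if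
`m` and `m'` do not have any non-constant common factor.» (for a binomial `f = m − m'`) — on the exponent vectors `a, a'`
of `m, m'`: no variable divides both. [claim: Hu2025, status: under-review]
STATUS: candidate statement under adjudication (D-0012/D-0089); not asserted. -/
def HasNoCommonFactor (a a' : σ ⊕ T →₀ ℕ) : Prop :=
  ∀ i : σ ⊕ T, a i = 0 ∨ a' i = 0

/-! ## Def. 4.11 ‹chunk Definition 4.10› (chunk p0022 l.153–173; PDF p.49) — parents, descendants, root polynomials -/

/-- **Hu 2025, Def. 4.11 ‹chunk Definition 4.10›, ONE DESCENT STEP at the block `F`** (chunk p0022 l.153–162; PDF p.49),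
verbatim: «Let `f = Σ_i x_{(u_i,v_i)} n_i ∈ R_{[k]} (⊂ R)` be a multi-homogeneous expression/polynomial, written as
above, which is allowed to be zero, such that `{x_{(u_i,v_i)}}` are a subset of homogeneous coordinates of `ℙ_F` for
some `F̄ ∈ 𝓕`. Set `f̄ = Σ_i x_{u_i} x_{v_i} n_i ∈ R_{[k]}`. Then, we call `f` a parent of `f̄` and `f̄` a descendant of
`f`.» — `g` arises from `f` by ONE such step: there is an expression (a finite list of pairs (`t_i`, `n_i`) with
`rel t_i = F`) with `f = Σ x_{t_i} n_i` and `g = Σ x̄_{t_i} n_i`, the parent `f` being multi-homogeneous as printed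
(so every `g` reached by such steps from a multi-homogeneous polynomial is again multi-homogeneous: each summand loses
exactly one degree in the block `F`). [claim: Hu2025, status: under-review]
STATUS: candidate statement under adjudication (D-0012/D-0089); not asserted. -/
def IsDescentStep [DecidableEq 𝔗] (F : 𝔗) (f g : ModelRing σ T k) : Prop :=
  IsMultiHomogeneous (k := k) (σ := σ) rel f ∧
  ∃ l : List (T × ModelRing σ T k), (∀ p ∈ l, rel p.1 = F) ∧
    f = (l.map fun p : T × ModelRing σ T k => (rhoVar (k := k) (σ := σ) p.1) * p.2).sum ∧
    g = (l.map fun p : T × ModelRing σ T k => (toModel (T := T) (img (k := k) mono p.1)) * p.2).sum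

/-- **Hu 2025, Def. 4.11 ‹4.10›, «`f` is a parent of `g`» / «`g` is a descendant of `f`»** (chunk p0022 l.162–165; PDF
p.49), verbatim: «Further, if `f` is a parent of `g`, and `g` is parent of `h`, then we also say `f` is a parent of `h`
and `h` is a descendant of `f`.» — the reflexive–transitive closure of the one-step relation `IsDescentStep` (at any
block). [claim: Hu2025, status: under-review]
STATUS: candidate statement under adjudication (D-0012/D-0089); not asserted. -/
def IsParentOf [DecidableEq 𝔗] (f g : ModelRing σ T k) : Prop :=
  Relation.ReflTransGen (fun f' g' : ModelRing σ T k => ∃ F : 𝔗, IsDescentStep (k := k) rel mono F f' g') f g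

/-- **Hu 2025, Def. 4.11** — numbered alias of `IsParentOf` (PDF Def. 4.11 = chunk «Definition 4.10», p0022
l.153–173; p.49): `Def4_11 rel mono f g` reads «`f` is a parent of `g`», i.e. «`g` is a descendant of `f`».
[claim: Hu2025, status: under-review]
STATUS: candidate statement under adjudication (D-0012/D-0089); not asserted. -/
abbrev Def4_11 [DecidableEq 𝔗] (f g : ModelRing σ T k) : Prop := IsParentOf (k := k) rel mono f g

/-- **Hu 2025, Def. 4.11 ‹4.10›, root polynomial** (chunk p0022 l.167–169; PDF p.49), verbatim: «Moreover, if a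
multi-homogeneous polynomial `f ∈ R_{[k]}` does not admit any parent other than itself, then we say `f` is root
polynomial.» (the text also says «root binomial» for a binomial that is a root polynomial, e.g. chunk p0023 l.124,
p0025 l.141). [claim: Hu2025, status: under-review]
STATUS: candidate statement under adjudication (D-0012/D-0089); not asserted. -/
def IsRootPolynomial [DecidableEq 𝔗] (f : ModelRing σ T k) : Prop :=
  IsMultiHomogeneous (k := k) (σ := σ) rel f ∧ ∀ g : ModelRing σ T k, IsParentOf (k := k) rel mono g f → g = f

/-- **Hu 2025, Def. 4.11 ‹4.10›, root parent** (chunk p0022 l.170–171; PDF p.49), verbatim: «In particular, `f` is a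
root parent of `g` if it is a root polynomial and a parent of `g`.» [claim: Hu2025, status: under-review]
STATUS: candidate statement under adjudication (D-0012/D-0089); not asserted. -/
def IsRootParentOf [DecidableEq 𝔗] (f g : ModelRing σ T k) : Prop :=
  IsRootPolynomial (k := k) rel mono f ∧ IsParentOf (k := k) rel mono f g

/-- **Hu 2025, unnumbered claim chunk p0022 l.173; PDF p.49** (end of Def. 4.11), verbatim: «One sees that if `f`
belongs to `ker^{mh} φ_{[k]}` if and only if any of its descendant does.» — for the relations `Φ` in play (printed
`Φ = 𝓕_{[k]}`): along the parent relation, membership in `ker^{mh} φ_Φ` is invariant. Typed claim.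
[claim: Hu2025, status: under-review]
STATUS: candidate statement under adjudication (D-0012/D-0089); not asserted. -/
def C22L173 [DecidableEq 𝔗] (Φ : Set 𝔗) : Prop :=
  ∀ f g : ModelRing σ T k, IsParentOf (k := k) rel mono f g →
    (f ∈ kerMH (k := k) rel mono Φ ↔ g ∈ kerMH (k := k) rel mono Φ)

/-! ## Def. 4.12 ‹chunk Definition 4.11› (chunk p0023 l.5–26; PDF p.49–50) — partial descendants -/

/-- **Hu 2025, Def. 4.12 ‹chunk Definition 4.11›, ONE PARTIAL DESCENT STEP at the block `F` — AS PRINTED** (chunk p0023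
l.5–20; PDF p.49 L036–p.50 L013), verbatim: «Let `f = Σ_{i ∈ I} x_{(u_i,v_i)} n_i ∈ R_{[k]} (⊂ R)` be a multi-homogeneous
expression/polynomial, written as above, which is allowed to be zero, such that `{x_{(u_i,v_i)}}` are a subset of
homogeneous coordinates of `ℙ_F` for some `F̄ ∈ 𝓕`. Let `I = I_1 ⊔ I_2` be a disjoint union. Set `f̄ = Σ_{i ∈ I_1}
p_{u_i} p_{v_i} n_i + Σ_{i ∈ I_2} x_{(u_i,v_i)} n_i ∈ R_{[k]} ∈ R_{[k]}.` -- sic («`p_{u_i} p_{v_i}`» for `x_{u_i}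
x_{v_i}`; «`∈ R_{[k]}`» printed twice) «Note that `f̄` is non-homogeneous if `I_1, I_2 ≠ ∅`. Then, we call `f` a
parent of `f̄` and `f̄` a partial descendant of `f`.» — the split `I_1 ⊔ I_2` is a Boolean tag per entry of the
expression (`true` = replaced, `i ∈ I_1`); AS PRINTED the split is arbitrary (both parts may be empty) and the standing
hypothesis «`f` multi-homogeneous» (l.6) is KEPT at every step (reading R1: the polynomial `f`; cofactors `n_i` free).
Sibling without that hypothesis: `IsPartialDescentStep_ours` (res-type-044's rendering); term-wise reading:
`IsPartialDescentStepR2`. [claim: Hu2025, status: under-review]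
STATUS: candidate statement under adjudication (D-0012/D-0089); not asserted. -/
def IsPartialDescentStep [DecidableEq 𝔗] (F : 𝔗) (f g : ModelRing σ T k) : Prop :=
  IsMultiHomogeneous (k := k) (σ := σ) rel f ∧
  ∃ l : List (T × ModelRing σ T k × Bool), (∀ p ∈ l, rel p.1 = F) ∧
    f = (l.map fun p : T × ModelRing σ T k × Bool => (rhoVar (k := k) (σ := σ) p.1) * p.2.1).sum ∧
    g = (l.map fun p : T × ModelRing σ T k × Bool =>
      (if p.2.2 then toModel (T := T) (img (k := k) mono p.1) else rhoVar (k := k) (σ := σ) p.1) * p.2.1).sum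

/-- **Hu 2025, Def. 4.12 ‹chunk Definition 4.11›, ONE PARTIAL DESCENT STEP — OURS reading (res-type-044)** (chunk p0023
l.5–20; PDF p.49 L036–p.50 L013): the same step WITHOUT folding in the standing hypothesis «`f` multi-homogeneous», so
that the chaining sentence l.22–23 («if `f` is a parent of `g`, and `g` is parent of `h` …») can pass through the
non-homogeneous intermediate `g` (l.18 «`f̄` is non-homogeneous if `I_1, I_2 ≠ ∅`»); the consumer puts
multi-homogeneity on the root of the chain where the print does (Def. 4.15: «partial descendant of a multi-homogenous
binomial»). Labelled OURS per PARTITION-HU §6 (e) (res-ref-a10 M-HU PRE-READ NOTE 2026-08-27T05:52:29Z); sibling of the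
AS PRINTED `IsPartialDescentStep`. [claim: Hu2025, status: under-review]
STATUS: candidate statement under adjudication (D-0012/D-0089); not asserted. -/
def IsPartialDescentStep_ours (F : 𝔗) (f g : ModelRing σ T k) : Prop :=
  ∃ l : List (T × ModelRing σ T k × Bool), (∀ p ∈ l, rel p.1 = F) ∧
    f = (l.map fun p : T × ModelRing σ T k × Bool => (rhoVar (k := k) (σ := σ) p.1) * p.2.1).sum ∧
    g = (l.map fun p : T × ModelRing σ T k × Bool =>
      (if p.2.2 then toModel (T := T) (img (k := k) mono p.1) else rhoVar (k := k) (σ := σ) p.1) * p.2.1).sum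

/-- **Hu 2025, Def. 4.12 ‹4.11›, «`g` is a partial descendant of `f`» — AS PRINTED** (chunk p0023 l.19–23; PDF p.50
L012–L015), verbatim: «Further, if `f` is a parent of `g`, and `g` is parent of `h`, then we also say `f` is a parent of
`h` and `h` is a partial descendant of `f`.» — reflexive–transitive closure of the AS-PRINTED one-step partial relation
(at any block; every step starts from a multi-homogeneous polynomial). [claim: Hu2025, status: under-review]
STATUS: candidate statement under adjudication (D-0012/D-0089); not asserted. -/
def IsPartialParentOf [DecidableEq 𝔗] (f g : ModelRing σ T k) : Prop :=
  Relation.ReflTransGen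
    (fun f' g' : ModelRing σ T k => ∃ F : 𝔗, IsPartialDescentStep (k := k) rel mono F f' g') f g

/-- **Hu 2025, Def. 4.12 ‹4.11›, «`g` is a partial descendant of `f`» — OURS reading** (chunk p0023 l.19–23; PDF p.50
L012–L015): reflexive–transitive closure of `IsPartialDescentStep_ours` (chains may pass through non-homogeneous
polynomials). Sibling of `IsPartialParentOf`. [claim: Hu2025, status: under-review]
STATUS: candidate statement under adjudication (D-0012/D-0089); not asserted. -/
def IsPartialParentOf_ours (f g : ModelRing σ T k) : Prop :=
  Relation.ReflTransGen
    (fun f' g' : ModelRing σ T k => ∃ F : 𝔗, IsPartialDescentStep_ours (k := k) rel mono F f' g') f g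

/-- **Hu 2025, Def. 4.12** — numbered alias of `IsPartialParentOf` (AS PRINTED; PDF Def. 4.12 = chunk «Definition
4.11», p0023 l.5–26; p.49 L036–p.50 L016): `Def4_12 rel mono f g` reads «`g` is a partial descendant of `f`».
[claim: Hu2025, status: under-review]
STATUS: candidate statement under adjudication (D-0012/D-0089); not asserted. -/
abbrev Def4_12 [DecidableEq 𝔗] (f g : ModelRing σ T k) : Prop := IsPartialParentOf (k := k) rel mono f g

/-- **Hu 2025, Def. 4.12 — OURS reading**, numbered alias of `IsPartialParentOf_ours`.
[claim: Hu2025, status: under-review]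
STATUS: candidate statement under adjudication (D-0012/D-0089); not asserted. -/
abbrev Def4_12_ours (f g : ModelRing σ T k) : Prop := IsPartialParentOf_ours (k := k) rel mono f g

/-- **Hu 2025, unnumbered claim chunk p0023 l.25–26; PDF p.50 L016** (end of Def. 4.12), verbatim: «One sees that if
`f` belongs to `ker φ_{[k]}` if and only if any of its partial descendant does.» (here `ker φ`, not `ker^{mh}`: a
partial descendant is not multi-homogeneous) — along the AS-PRINTED partial parent relation. Typed claim.
[claim: Hu2025, status: under-review]
STATUS: candidate statement under adjudication (D-0012/D-0089); not asserted. -/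
def C23L25 [DecidableEq 𝔗] (rel : T → 𝔗) (mono : T → (σ →₀ ℕ)) : Prop :=
  ∀ f g : ModelRing σ T k, IsPartialParentOf (k := k) rel mono f g →
    (varphi (k := k) mono f = 0 ↔ varphi (k := k) mono g = 0)

/-- **The same claim along the OURS partial parent relation** (`IsPartialParentOf_ours`). Typed claim.
[claim: Hu2025, status: under-review]
STATUS: candidate statement under adjudication (D-0012/D-0089); not asserted. -/
def C23L25_ours (rel : T → 𝔗) (mono : T → (σ →₀ ℕ)) : Prop :=
  ∀ f g : ModelRing σ T k, IsPartialParentOf_ours (k := k) rel mono f g →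
    (varphi (k := k) mono f = 0 ↔ varphi (k := k) mono g = 0)

end Descendants

noncomputable section

section WpReduction

universe u v w x

variable {k : Type u} [CommRing k] {σ : Type v} {T : Type w} {𝔗 : Type x}
variable (rel : T → 𝔗) (mono : T → (σ →₀ ℕ))

/-! ## Lem. 4.9 ‹chunk Lemma 4.8› (p0022 l.112–134; p.48 L036–p.49 L011) and Lem. 4.8 ‹chunk Lemma 4.7› (p0022 l.74–106;
p.48 L013–L032) — both [OPT] in PARTITION-HU row 103 -/

/-- **Hu 2025, Lem. 4.9 ‹chunk Lemma 4.8›** (chunk p0022 l.112–119, proof l.121–134; PDF p.48 L036–L040,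
proof p.49 L003–L011), verbatim: «Consider a nonzero binomial `m − m′ ∈ ker^mh φ_[k]`. Suppose `x_(u,v) ∣ m`
(resp. `m′`) and `x_u x_v ∣ m′` (resp. `m`). Then, `m − m′` is ℘-reducible and `m − m′ ≡ x_(u,v)(n − n′)`,
`mod B^℘_[k]`.» Typed on the exponent vectors `a, a′` of `m, m′` (as Def. 4.7): the ϱ-variable `x_(u,v)` is
`rhoVar t`, `x_u x_v` its chart monomial (`monoR mono t` on exponents); the congruence «`≡ … mod B^℘_[k]`» is
read as: for some `n, n′ ∈ R`, the difference `(m − m′) − x_(u,v)(n − n′)` lies in the ideal of `R` generated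
by `B^℘_[k]` (`wpBinomials rel mono Φ`), `Φ` the relations in play (printed `Φ = 𝓕_[k]`). [OPT] item of
PARTITION-HU row 103, typed for completeness; not read by any joint. [claim: Hu2025, status: under-review]
STATUS: candidate statement under adjudication (D-0012/D-0089); not asserted. -/
def Lem4_9 [DecidableEq 𝔗] (Φ : Set 𝔗) : Prop :=
  ∀ (a a' : σ ⊕ T →₀ ℕ) (t : T),
    (monomial a (1 : k) - monomial a' 1 : ModelRing σ T k) ≠ 0 →
    (monomial a (1 : k) - monomial a' 1 : ModelRing σ T k) ∈ kerMH (k := k) rel mono Φ →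
    ((Finsupp.single (Sum.inr t) 1 ≤ a ∧ monoR mono t ≤ a') ∨
      (Finsupp.single (Sum.inr t) 1 ≤ a' ∧ monoR mono t ≤ a)) →
    IsWpReducible (k := k) rel mono Φ a a' ∧
      ∃ n n' : ModelRing σ T k,
        (monomial a (1 : k) - monomial a' 1) - rhoVar (k := k) (σ := σ) t * (n - n') ∈
          Ideal.span (wpBinomials (k := k) rel mono Φ)

/-- **Hu 2025, Lem. 4.8 ‹chunk Lemma 4.7›** (chunk p0022 l.74–85, proof l.87–106; PDF p.48 L013–L019, proof L020–L032),
verbatim: «Let `F_(123,abc) ∈ 𝓕` be of rank one. Consider a nonzero binomial `m − m′ ∈ ker^mh φ_[k]`, having no common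
factor. If `x_(123,abc)`, respectively, `x_abc` divides `m`, then `x_abc`, respectively, `x_(123,abc)` divides `m′`.
Consequently, we have that `m − m′` is ℘-reducible and `m − m′ ≡ x_(123,abc)(n − n′)`, `mod B^℘_[k]`.» Typed on the
exponent vectors `a, a′` of `m, m′` (as Def. 4.7), with two PLATFORM PARAMETERS of rows 101/102/105 made explicit:
`rk : 𝔗 → ℕ` the rank of a primary relation (I-PL `rkPrimary`; «of rank one» = `rk F = 1`) and `head : 𝔗 → T` the
leading term `s_F` of `F` (I-GOV `head`; its ϱ-variable `x_((123),u_F)` = `rhoVar (head F)`, and «`x_abc`» = the chart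
monomial `x̄_{s_F}`, exponent `monoR mono (head F)`). «`≡ … mod B^℘_[k]`» is read as for `Lem4_9`; the «Consequently»
clause is typed under the disjunction of the two divisibility hypotheses. [OPT]; not read by any joint.
[claim: Hu2025, status: under-review]
STATUS: candidate statement under adjudication (D-0012/D-0089); not asserted. -/
def Lem4_8 [DecidableEq 𝔗] (rk : 𝔗 → ℕ) (head : 𝔗 → T) (Φ : Set 𝔗) : Prop :=
  ∀ (F : 𝔗) (a a' : σ ⊕ T →₀ ℕ), rk F = 1 →
    (monomial a (1 : k) - monomial a' 1 : ModelRing σ T k) ≠ 0 →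
    (monomial a (1 : k) - monomial a' 1 : ModelRing σ T k) ∈ kerMH (k := k) rel mono Φ →
    HasNoCommonFactor (σ := σ) (T := T) a a' →
    ((Finsupp.single (Sum.inr (head F)) 1 ≤ a → monoR mono (head F) ≤ a') ∧
      (monoR mono (head F) ≤ a → Finsupp.single (Sum.inr (head F)) 1 ≤ a')) ∧
    (Finsupp.single (Sum.inr (head F)) 1 ≤ a ∨ monoR mono (head F) ≤ a →
      IsWpReducible (k := k) rel mono Φ a a' ∧
        ∃ n n' : ModelRing σ T k,
          (monomial a (1 : k) - monomial a' 1) - rhoVar (k := k) (σ := σ) (head F) * (n - n') ∈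
            Ideal.span (wpBinomials (k := k) rel mono Φ))

end WpReduction

section DescendantsR2

/-! ## Def. 4.11 / Def. 4.12 — READING R2 («multi-homogeneous EXPRESSION»: term-wise)

The printed «Let `f = Σ_i x_(u_i,v_i) 𝐧_i ∈ R_[k] (⊂ R)` be a multi-homogeneous expression/polynomial, written as
above, which is allowed to be zero» (chunk p0022 l.154–158; p0023 l.6–10) is typed in TWO readings. R1 (the decls
`IsDescentStep` … `C23L25_ours` above, res-type-044's rendering; Def. 4.12's partial step there in an AS PRINTED and
an OURS variant): the POLYNOMIAL `f` is multi-homogeneous and the cofactors `n_i` range over `R`. R2 (this section): the EXPRESSION is multi-homogeneous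
— every written summand `x_(u_i,v_i) 𝐧_i` is a TERM (`𝐧_i` a monomial with its coefficient, the paper's bold-face
letters `𝐦, 𝐧` denoting monomials: chunk p0021 l.167–169 «We express it as the sum of its monomials `f = Σ 𝐦_i`»,
Def. 4.7 chunk p0022 l.54–55 «`𝐦 = x_(u,v) 𝐧`») lying in `R_[k]`, and all summands have ONE common multidegree
(the written sum may still cancel to `0`, «allowed to be zero», Ex. 4.14 ‹chunk 4.13› p0023 l.35–45). Both readings
are candidates; neither is asserted to be the author's; consumers (row 104: Def. 4.15, 4.19, 4.32) and the lanes read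
both. R2 carries the set `Φ` of relations in play (printed `𝓕_[k]`) because «`∈ R_[k]`» is part of it. -/

universe u v w x

variable {k : Type u} [CommRing k] {σ : Type v} {T : Type w} {𝔗 : Type x}
variable (rel : T → 𝔗) (mono : T → (σ →₀ ℕ))

/-- The written summand `x_(u_i,v_i) 𝐧_i` of a term-wise expression (reading R2 of Def. 4.11/4.12; chunk p0022
l.154, p0023 l.6): the ϱ-variable `x_t` times the term `c · x^a` (`p = (t, a, c)`). Plumbing.
[claim: Hu2025, status: under-review]
STATUS: candidate statement under adjudication (D-0012/D-0089); not asserted. -/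
def exprSummand (p : T × (σ ⊕ T →₀ ℕ) × k) : ModelRing σ T k :=
  rhoVar (k := k) (σ := σ) p.1 * monomial p.2.1 p.2.2

/-- The DESCENDED summand `x_{u_i} x_{v_i} 𝐧_i` of a written summand `x_(u_i,v_i) 𝐧_i` (Def. 4.11 «Set
`f̄ = Σ_i x_{u_i} x_{v_i} 𝐧_i`», chunk p0022 l.160; reading R2): the chart monomial `x̄_t ∈ R_0 ⊂ R` times the
term `c · x^a`. Plumbing. [claim: Hu2025, status: under-review]
STATUS: candidate statement under adjudication (D-0012/D-0089); not asserted. -/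
def exprSummandBar (p : T × (σ ⊕ T →₀ ℕ) × k) : ModelRing σ T k :=
  toModel (T := T) (img (k := k) mono p.1) * monomial p.2.1 p.2.2

/-- **Reading R2 of «multi-homogeneous expression `f = Σ_i x_(u_i,v_i) 𝐧_i ∈ R_[k]` … such that `{x_(u_i,v_i)}`
are a subset of homogeneous coordinates of `ℙ_F` for some `F̄ ∈ 𝓕`»** (Def. 4.11 chunk p0022 l.154–158 = Def. 4.12
chunk p0023 l.6–10; PDF p.49 L019–L022, L036–p.50 L003): a finite list of written summands `(t_i, a_i, c_i)`
(`= x_{t_i} · c_i x^{a_i}`) with every `x_{t_i}` a coordinate of the block `F` (`rel t_i = F`), every summand in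
`R_[k]` (`RSub rel Φ`), and ONE common multidegree `D` (block by block: each summand is weighted-homogeneous of
degree `D G` for the block weight of every `G`). [claim: Hu2025, status: under-review]
STATUS: candidate statement under adjudication (D-0012/D-0089); not asserted. -/
def IsMHExpression [DecidableEq 𝔗] (Φ : Set 𝔗) (F : 𝔗) (l : List (T × (σ ⊕ T →₀ ℕ) × k)) : Prop :=
  ∃ D : 𝔗 → ℕ, ∀ p ∈ l, rel p.1 = F ∧ exprSummand (k := k) (σ := σ) p ∈ RSub (k := k) rel Φ ∧
    ∀ G : 𝔗, IsWeightedHomogeneous (blockWeight rel G) (exprSummand (k := k) (σ := σ) p) (D G)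

/-- **Hu 2025, Def. 4.11 ‹chunk Definition 4.10›, ONE DESCENT STEP at the block `F` — reading R2 (term-wise
expression)** (chunk p0022 l.153–162; PDF p.49 L019–L027), verbatim as for `IsDescentStep`: «… Set `f̄ = Σ_i x_{u_i}
x_{v_i} 𝐧_i ∈ R_[k]`. Then, we call `f` a parent of `f̄` and `f̄` a descendant of `f`.» — `f` is the value of a
multi-homogeneous term-wise expression (`IsMHExpression`) over the block `F` in `R_[k]` and `g` the value of the
descended expression. Sibling of `IsDescentStep` (reading R1); see the section docstring for the two readings.
[claim: Hu2025, status: under-review]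
STATUS: candidate statement under adjudication (D-0012/D-0089); not asserted. -/
def IsDescentStepR2 [DecidableEq 𝔗] (Φ : Set 𝔗) (F : 𝔗) (f g : ModelRing σ T k) : Prop :=
  ∃ l : List (T × (σ ⊕ T →₀ ℕ) × k), IsMHExpression (k := k) (σ := σ) rel Φ F l ∧
    f = (l.map (exprSummand (k := k) (σ := σ))).sum ∧
    g = (l.map (exprSummandBar (k := k) (σ := σ) mono)).sum

/-- **Hu 2025, Def. 4.11 ‹4.10›, «`f` is a parent of `g`» — reading R2** (chunk p0022 l.162–165; PDF p.49
L027–L029): the reflexive–transitive closure of `IsDescentStepR2` (at any block), sibling of `IsParentOf` (R1).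
[claim: Hu2025, status: under-review]
STATUS: candidate statement under adjudication (D-0012/D-0089); not asserted. -/
def IsParentOfR2 [DecidableEq 𝔗] (Φ : Set 𝔗) (f g : ModelRing σ T k) : Prop :=
  Relation.ReflTransGen
    (fun f' g' : ModelRing σ T k => ∃ F : 𝔗, IsDescentStepR2 (k := k) rel mono Φ F f' g') f g

/-- **Hu 2025, Def. 4.11** — numbered alias of `IsParentOfR2` (reading R2 of PDF Def. 4.11 = chunk «Definition
4.10», p0022 l.153–173; p.49): `Def4_11_R2 rel mono Φ f g` reads «`f` is a parent of `g`» term-wise in `R_[k]`.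
[claim: Hu2025, status: under-review]
STATUS: candidate statement under adjudication (D-0012/D-0089); not asserted. -/
abbrev Def4_11_R2 [DecidableEq 𝔗] (Φ : Set 𝔗) (f g : ModelRing σ T k) : Prop :=
  IsParentOfR2 (k := k) rel mono Φ f g

/-- **Hu 2025, Def. 4.11 ‹4.10›, root polynomial — reading R2** (chunk p0022 l.167–169; PDF p.49 L030–L031): a
multi-homogeneous `f ∈ R_[k]` admitting no term-wise parent other than itself; sibling of `IsRootPolynomial` (R1).
[claim: Hu2025, status: under-review]
STATUS: candidate statement under adjudication (D-0012/D-0089); not asserted. -/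
def IsRootPolynomialR2 [DecidableEq 𝔗] (Φ : Set 𝔗) (f : ModelRing σ T k) : Prop :=
  f ∈ RSub (k := k) rel Φ ∧ IsMultiHomogeneous (k := k) (σ := σ) rel f ∧
    ∀ g : ModelRing σ T k, IsParentOfR2 (k := k) rel mono Φ g f → g = f

/-- **Hu 2025, Def. 4.11 ‹4.10›, root parent — reading R2** (chunk p0022 l.170–171; PDF p.49 L031–L032): «`f` is
a root parent of `g` if it is a root polynomial and a parent of `g`», term-wise; sibling of `IsRootParentOf` (R1).
[claim: Hu2025, status: under-review]
STATUS: candidate statement under adjudication (D-0012/D-0089); not asserted. -/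
def IsRootParentOfR2 [DecidableEq 𝔗] (Φ : Set 𝔗) (f g : ModelRing σ T k) : Prop :=
  IsRootPolynomialR2 (k := k) rel mono Φ f ∧ IsParentOfR2 (k := k) rel mono Φ f g

/-- **Hu 2025, unnumbered claim chunk p0022 l.173; PDF p.49 L033 — reading R2**, verbatim: «One sees that if `f`
belongs to `ker^{mh} φ_{[k]}` if and only if any of its descendant does.» — along the term-wise parent relation
`IsParentOfR2 Φ`, membership in `ker^{mh} φ_Φ` is invariant. Sibling of `C22L173` (reading R1). Typed claim.
[claim: Hu2025, status: under-review]
STATUS: candidate statement under adjudication (D-0012/D-0089); not asserted. -/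
def C22L173_R2 [DecidableEq 𝔗] (Φ : Set 𝔗) : Prop :=
  ∀ f g : ModelRing σ T k, IsParentOfR2 (k := k) rel mono Φ f g →
    (f ∈ kerMH (k := k) rel mono Φ ↔ g ∈ kerMH (k := k) rel mono Φ)

/-- **Hu 2025, Def. 4.12 ‹chunk Definition 4.11›, ONE PARTIAL DESCENT STEP at the block `F` — reading R2 (term-wise
expression)** (chunk p0023 l.5–20; PDF p.49 L036–p.50 L013), verbatim as for `IsPartialDescentStep`: «… Let
`I = I_1 ⊔ I_2` be a disjoint union. Set `f̄ = Σ_{i ∈ I_1} p_{u_i} p_{v_i} 𝐧_i + Σ_{i ∈ I_2} x_(u_i,v_i) 𝐧_i`» -- sic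
(«`p_{u_i} p_{v_i}`» for `x_{u_i} x_{v_i}`) — the expression is a multi-homogeneous term-wise expression over the
block `F` in `R_[k]` (`IsMHExpression` on the underlying list), each summand tagged (`true` = `i ∈ I_1`,
descended). Sibling of `IsPartialDescentStep` (AS PRINTED, polynomial multi-homogeneous) and `IsPartialDescentStep_ours`.
[claim: Hu2025, status: under-review]
STATUS: candidate statement under adjudication (D-0012/D-0089); not asserted. -/
def IsPartialDescentStepR2 [DecidableEq 𝔗] (Φ : Set 𝔗) (F : 𝔗) (f g : ModelRing σ T k) : Prop :=
  ∃ l : List ((T × (σ ⊕ T →₀ ℕ) × k) × Bool),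
    IsMHExpression (k := k) (σ := σ) rel Φ F (l.map Prod.fst) ∧
    f = (l.map fun q => exprSummand (k := k) (σ := σ) q.1).sum ∧
    g = (l.map fun q => if q.2 then exprSummandBar (k := k) (σ := σ) mono q.1
      else exprSummand (k := k) (σ := σ) q.1).sum

/-- **Hu 2025, Def. 4.12 ‹4.11›, «`g` is a partial descendant of `f`» — reading R2** (chunk p0023 l.19–23; PDF
p.50 L012–L015): reflexive–transitive closure of `IsPartialDescentStepR2` (at any block); sibling of
`IsPartialParentOf` (R1). [claim: Hu2025, status: under-review]
STATUS: candidate statement under adjudication (D-0012/D-0089); not asserted. -/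
def IsPartialParentOfR2 [DecidableEq 𝔗] (Φ : Set 𝔗) (f g : ModelRing σ T k) : Prop :=
  Relation.ReflTransGen
    (fun f' g' : ModelRing σ T k => ∃ F : 𝔗, IsPartialDescentStepR2 (k := k) rel mono Φ F f' g') f g

/-- **Hu 2025, Def. 4.12** — numbered alias of `IsPartialParentOfR2` (reading R2 of PDF Def. 4.12 = chunk
«Definition 4.11», p0023 l.5–26; p.49–50): `Def4_12_R2 rel mono Φ f g` reads «`g` is a partial descendant of
`f`» term-wise in `R_[k]`. [claim: Hu2025, status: under-review]
STATUS: candidate statement under adjudication (D-0012/D-0089); not asserted. -/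
abbrev Def4_12_R2 [DecidableEq 𝔗] (Φ : Set 𝔗) (f g : ModelRing σ T k) : Prop :=
  IsPartialParentOfR2 (k := k) rel mono Φ f g

/-- **Hu 2025, unnumbered claim chunk p0023 l.25–26; PDF p.50 L016 — reading R2**, verbatim: «One sees that if
`f` belongs to `ker φ_{[k]}` if and only if any of its partial descendant does.» — along `IsPartialParentOfR2 Φ`,
membership in `ker φ` is invariant. Sibling of `C23L25` (reading R1). Typed claim.
[claim: Hu2025, status: under-review]
STATUS: candidate statement under adjudication (D-0012/D-0089); not asserted. -/
def C23L25_R2 [DecidableEq 𝔗] (Φ : Set 𝔗) : Prop :=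
  ∀ f g : ModelRing σ T k, IsPartialParentOfR2 (k := k) rel mono Φ f g →
    (varphi (k := k) mono f = 0 ↔ varphi (k := k) mono g = 0)

end DescendantsR2

end

end Literature.AlgebraicGeometry.Hu2025.Statements.S04ModelV
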